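import Mathlib.Data.Nat.Choose.Basic
import Mathlib.Algebra.BigOperators.Intervals
import Mathlib.Algebra.Order.BigOperators.Group.Finset
import Mathlib.Tactic
import Summits.CriticalPhenomena.PercolationContinuityZ3.Theorems.PercNearOneGluingNoHeavyLowerTailHypMoments
import Summits.CriticalPhenomena.PercolationContinuityZ3.Theorems.PercNearOneGluingNoHeavyLowerTailULC
import HarnessLib

/-!
# THEOREM U-LC with the explicit constant: the untilted two-block sum

Support file for the Sahi / Conjecture-P programme of route `PercNearOneGluingNoHeavy`
(`--supports stmt-CriticalPhenomena-4575`, prover prim-l12-p5 gen 28; proof note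
`prim-l12-p5/U-STRUCTURE-g28.md` §0, §3).  No definitions, no named facts, no sorries.

`ULC.u_lc` proves CONJECTURE U in the log-concave regime for every `κ ≥ 0` making the UNTILTED sum
`T(1,1) = ∑_{x₁,x₂} C(M₁,x₁)C(M₂,x₂)C(L,K-x₁-x₂)(κ + (2x₁-M₁)(2x₂-M₂))` nonnegative.  Here that sum is
computed (multivariate hypergeometric covariance): with `N = M₁+M₂+L` and `j = N-2K`,
`T(1,1) = C(N,K)·[κ + M₁M₂(j²-N)/(N(N-1))]`,
so the condition is `κ ≥ M₁M₂(N-j²)/(N(N-1))` — the constant of CONJECTURE U (OMEGA1-g27 §5.6).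

* `guard_to_range` : a guarded sum over `range (n+1)` is the hypergeometric sum over `range (k+1)`;
* `F_one`, `Mo_one` : the untilted block sums `F(k) = C(n₂,k)`, `n₂·Mo(k) = M₂(2k-n₂)C(n₂,k)`;
* `untilted_total` : `N(N-1)n₂ · T(1,1) = n₂ C(N,K) [κN(N-1) + M₁M₂((N-2K)²-N)]`;
* `u_lc_kappa` : THEOREM U-LC with the hypothesis `κN(N-1) ≥ M₁M₂(N-(N-2K)²)` in place of `T(1,1) ≥ 0`;
  `u_lc_kappa_zero`, `u_lc_kappa_one` : the unconditional cases `j = 0, 1`.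
-/

namespace Summit.CriticalPhenomena.PercolationContinuityZ3.Theorems

namespace ULCKappa

open Finset

/-- A guarded block sum over `range (n+1)` equals the hypergeometric sum over `range (k+1)`. -/
theorem guard_to_range (n L k : ℕ) (f : ℕ → ℝ) :
    ∑ x ∈ range (n + 1), (n.choose x : ℝ) * (if x ≤ k then (L.choose (k - x) : ℝ) else 0) * f x =
      ∑ x ∈ range (k + 1), (n.choose x : ℝ) * (L.choose (k - x) : ℝ) * f x := by
  have h1 : ∑ x ∈ range (n + 1), (n.choose x : ℝ) * (if x ≤ k then (L.choose (k - x) : ℝ) else 0) * f x =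
      ∑ x ∈ range (n + k + 2), (n.choose x : ℝ) * (if x ≤ k then (L.choose (k - x) : ℝ) else 0) * f x := by
    apply sum_subset (range_subset_range.mpr (by omega))
    intro x _ hx
    have hxn : n < x := by
      have := mem_range.not.mp hx
      omega
    rw [Nat.choose_eq_zero_of_lt hxn]
    simp
  have h2 : ∑ x ∈ range (k + 1), (n.choose x : ℝ) * (L.choose (k - x) : ℝ) * f x =
      ∑ x ∈ range (n + k + 2), (n.choose x : ℝ) * (if x ≤ k then (L.choose (k - x) : ℝ) else 0) * f x := by
    have e : ∑ x ∈ range (k + 1), (n.choose x : ℝ) * (L.choose (k - x) : ℝ) * f x =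
        ∑ x ∈ range (k + 1), (n.choose x : ℝ) * (if x ≤ k then (L.choose (k - x) : ℝ) else 0) * f x := by
      refine sum_congr rfl fun x hx => ?_
      have : x ≤ k := by
        have := mem_range.mp hx
        omega
      rw [if_pos this]
    rw [e]
    apply sum_subset (range_subset_range.mpr (by omega))
    intro x _ hx
    have hxk : ¬ x ≤ k := by
      have := mem_range.not.mp hx
      omega
    rw [if_neg hxk]
    simp
  rw [h1, h2]

/-- The untilted block weight: `F(k) = ∑_x C(M,x)C(L,k-x) = C(M+L,k)`. -/
theorem F_one (M L k : ℕ) :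
    ∑ x ∈ range (M + 1), (M.choose x : ℝ) * (if x ≤ k then (L.choose (k - x) : ℝ) else 0) * 1 =
      ((M + L).choose k : ℝ) := by
  rw [guard_to_range M L k (fun _ => (1 : ℝ))]
  have e : ∑ x ∈ range (k + 1), (M.choose x : ℝ) * (L.choose (k - x) : ℝ) * (fun _ : ℕ => (1 : ℝ)) x =
      ∑ x ∈ range (k + 1), (M.choose x : ℝ) * (L.choose (k - x) : ℝ) := by
    refine sum_congr rfl fun x _ => ?_
    simp
  rw [e, HypMoments.vandermonde]

/-- The untilted block moment: `(M+L) · ∑_x C(M,x)C(L,k-x)(2x-M) = M(2k-M-L) C(M+L,k)`. -/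
theorem Mo_one (M L k : ℕ) :
    ((M : ℝ) + L) * ∑ x ∈ range (M + 1), (M.choose x : ℝ) *
        (if x ≤ k then (L.choose (k - x) : ℝ) else 0) * 1 * (2 * (x : ℝ) - M) =
      (M : ℝ) * (2 * (k : ℝ) - M - L) * ((M + L).choose k : ℝ) := by
  have e0 : ∑ x ∈ range (M + 1), (M.choose x : ℝ) *
        (if x ≤ k then (L.choose (k - x) : ℝ) else 0) * 1 * (2 * (x : ℝ) - M) =
      ∑ x ∈ range (M + 1), (M.choose x : ℝ) *
        (if x ≤ k then (L.choose (k - x) : ℝ) else 0) * (2 * (x : ℝ) - M) := by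
    refine sum_congr rfl fun x _ => ?_
    ring
  rw [e0, guard_to_range M L k (fun x => 2 * (x : ℝ) - M)]
  have e1 : ∑ x ∈ range (k + 1), (M.choose x : ℝ) * (L.choose (k - x) : ℝ) * (2 * (x : ℝ) - M) =
      2 * (∑ x ∈ range (k + 1), (x : ℝ) * (M.choose x : ℝ) * (L.choose (k - x) : ℝ)) -
        (M : ℝ) * ∑ x ∈ range (k + 1), (M.choose x : ℝ) * (L.choose (k - x) : ℝ) := by
    rw [mul_sum, mul_sum, ← sum_sub_distrib]
    refine sum_congr rfl fun x _ => ?_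
    ring
  rw [e1]
  have hfm := HypMoments.first_moment M L k
  rw [HypMoments.vandermonde] at hfm ⊢
  linear_combination (2 : ℝ) * hfm

/-- **The untilted two-block sum** (multivariate hypergeometric covariance):
`N(N-1)(M₂+L) · T(1,1) = (M₂+L) · C(N,K) · [κ N(N-1) + M₁M₂((N-2K)² - N)]`, `N = M₁+M₂+L`. -/
theorem untilted_total (M₁ M₂ L K : ℕ) (κ : ℝ) :
    (((M₁ + M₂ + L : ℕ) : ℝ) * (((M₁ + M₂ + L : ℕ) : ℝ) - 1) * ((M₂ : ℝ) + L)) *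
      ∑ x₁ ∈ range (M₁ + 1), ∑ x₂ ∈ range (M₂ + 1),
        (M₁.choose x₁ : ℝ) * 1 * ((M₂.choose x₂ : ℝ) * 1) *
          (if x₁ + x₂ ≤ K then (L.choose (K - (x₁ + x₂)) : ℝ) else 0) *
          (κ + (2 * (x₁ : ℝ) - M₁) * (2 * (x₂ : ℝ) - M₂)) =
      ((M₂ : ℝ) + L) * ((M₁ + M₂ + L).choose K : ℝ) *
        (κ * (((M₁ + M₂ + L : ℕ) : ℝ) * (((M₁ + M₂ + L : ℕ) : ℝ) - 1)) +
          (M₁ : ℝ) * M₂ * ((((M₁ + M₂ + L : ℕ) : ℝ) - 2 * K) ^ 2 - ((M₁ + M₂ + L : ℕ) : ℝ))) := by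
  -- sum over block 2 ∪ buffer first
  rw [ULC.triple_comm, ULC.outer_form M₂ M₁ L K κ (fun _ => (1 : ℝ)) (fun _ => (1 : ℝ))]
  -- closed forms of the inner sums
  have hin : ∀ x₁ ∈ range (M₁ + 1), ((M₂ : ℝ) + L) * ((M₁.choose x₁ : ℝ) * (fun _ : ℕ => (1 : ℝ)) x₁ *
      (if x₁ ≤ K then
        κ * (∑ x₂ ∈ range (M₂ + 1), (M₂.choose x₂ : ℝ) *
            (if x₂ ≤ K - x₁ then (L.choose (K - x₁ - x₂) : ℝ) else 0) * (fun _ : ℕ => (1 : ℝ)) x₂) +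
        (2 * (x₁ : ℝ) - M₁) * (∑ x₂ ∈ range (M₂ + 1), (M₂.choose x₂ : ℝ) *
            (if x₂ ≤ K - x₁ then (L.choose (K - x₁ - x₂) : ℝ) else 0) * (fun _ : ℕ => (1 : ℝ)) x₂ *
            (2 * (x₂ : ℝ) - M₂))
      else 0)) =
      (M₁.choose x₁ : ℝ) * (if x₁ ≤ K then ((M₂ + L).choose (K - x₁) : ℝ) else 0) *
        (κ * ((M₂ : ℝ) + L) + (2 * (x₁ : ℝ) - M₁) * ((M₂ : ℝ) * (2 * ((K - x₁ : ℕ) : ℝ) - M₂ - L))) := by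
    intro x₁ _
    by_cases hx : x₁ ≤ K
    · rw [if_pos hx, if_pos hx]
      have hF := F_one M₂ L (K - x₁)
      have hMo := Mo_one M₂ L (K - x₁)
      simp only at hF hMo ⊢
      rw [hF]
      have hMo' : ((M₂ : ℝ) + L) * ∑ x ∈ range (M₂ + 1), (M₂.choose x : ℝ) *
          (if x ≤ K - x₁ then (L.choose (K - x₁ - x) : ℝ) else 0) * 1 * (2 * (x : ℝ) - M₂) =
          (M₂ : ℝ) * (2 * ((K - x₁ : ℕ) : ℝ) - M₂ - L) * ((M₂ + L).choose (K - x₁) : ℝ) := hMo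
      linear_combination (M₁.choose x₁ : ℝ) * (2 * (x₁ : ℝ) - M₁) * hMo'
    · rw [if_neg hx, if_neg hx]
      ring
  rw [show (((M₁ + M₂ + L : ℕ) : ℝ) * (((M₁ + M₂ + L : ℕ) : ℝ) - 1) * ((M₂ : ℝ) + L)) *
      ∑ x₁ ∈ range (M₁ + 1), (M₁.choose x₁ : ℝ) * (fun _ : ℕ => (1 : ℝ)) x₁ *
        (if x₁ ≤ K then
          κ * (∑ x₂ ∈ range (M₂ + 1), (M₂.choose x₂ : ℝ) *
              (if x₂ ≤ K - x₁ then (L.choose (K - x₁ - x₂) : ℝ) else 0) * (fun _ : ℕ => (1 : ℝ)) x₂) +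
          (2 * (x₁ : ℝ) - M₁) * (∑ x₂ ∈ range (M₂ + 1), (M₂.choose x₂ : ℝ) *
              (if x₂ ≤ K - x₁ then (L.choose (K - x₁ - x₂) : ℝ) else 0) * (fun _ : ℕ => (1 : ℝ)) x₂ *
              (2 * (x₂ : ℝ) - M₂))
        else 0) =
      (((M₁ + M₂ + L : ℕ) : ℝ) * (((M₁ + M₂ + L : ℕ) : ℝ) - 1)) *
      ∑ x₁ ∈ range (M₁ + 1), ((M₂ : ℝ) + L) * ((M₁.choose x₁ : ℝ) * (fun _ : ℕ => (1 : ℝ)) x₁ *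
        (if x₁ ≤ K then
          κ * (∑ x₂ ∈ range (M₂ + 1), (M₂.choose x₂ : ℝ) *
              (if x₂ ≤ K - x₁ then (L.choose (K - x₁ - x₂) : ℝ) else 0) * (fun _ : ℕ => (1 : ℝ)) x₂) +
          (2 * (x₁ : ℝ) - M₁) * (∑ x₂ ∈ range (M₂ + 1), (M₂.choose x₂ : ℝ) *
              (if x₂ ≤ K - x₁ then (L.choose (K - x₁ - x₂) : ℝ) else 0) * (fun _ : ℕ => (1 : ℝ)) x₂ *
              (2 * (x₂ : ℝ) - M₂))
        else 0)) by rw [← mul_sum]; ring]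
  rw [sum_congr rfl hin]
  -- now a hypergeometric sum over x₁ ∈ range (K+1) for (M₁, M₂+L, K)
  have hpoly : ∀ x₁ : ℕ, (M₁.choose x₁ : ℝ) * (if x₁ ≤ K then ((M₂ + L).choose (K - x₁) : ℝ) else 0) *
        (κ * ((M₂ : ℝ) + L) + (2 * (x₁ : ℝ) - M₁) * ((M₂ : ℝ) * (2 * ((K - x₁ : ℕ) : ℝ) - M₂ - L))) =
      (M₁.choose x₁ : ℝ) * (if x₁ ≤ K then ((M₂ + L).choose (K - x₁) : ℝ) else 0) *
        (κ * ((M₂ : ℝ) + L) + (2 * (x₁ : ℝ) - M₁) * ((M₂ : ℝ) * (2 * ((K : ℝ) - x₁) - M₂ - L))) := by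
    intro x₁
    by_cases hx : x₁ ≤ K
    · rw [if_pos hx]
      push_cast [Nat.cast_sub hx]
      ring
    · rw [if_neg hx]
      ring
  simp_rw [hpoly]
  rw [guard_to_range M₁ (M₂ + L) K
    (fun x₁ => κ * ((M₂ : ℝ) + L) + (2 * (x₁ : ℝ) - M₁) * ((M₂ : ℝ) * (2 * ((K : ℝ) - x₁) - M₂ - L)))]
  -- expand the polynomial weight into 1, x₁, x₁(x₁-1)
  have hexp : ∑ x ∈ range (K + 1), (M₁.choose x : ℝ) * ((M₂ + L).choose (K - x) : ℝ) *
      (fun x₁ : ℕ => κ * ((M₂ : ℝ) + L) + (2 * (x₁ : ℝ) - M₁) * ((M₂ : ℝ) * (2 * ((K : ℝ) - x₁) - M₂ - L))) x =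
      (κ * ((M₂ : ℝ) + L) - (M₁ : ℝ) * M₂ * (2 * (K : ℝ) - M₂ - L)) *
          (∑ x ∈ range (K + 1), (M₁.choose x : ℝ) * ((M₂ + L).choose (K - x) : ℝ)) +
        (M₂ : ℝ) * (4 * (K : ℝ) - 2 * M₂ - 2 * L + 2 * M₁ - 4) *
          (∑ x ∈ range (K + 1), (x : ℝ) * (M₁.choose x : ℝ) * ((M₂ + L).choose (K - x) : ℝ)) -
        4 * (M₂ : ℝ) *
          (∑ x ∈ range (K + 1), (x : ℝ) * ((x : ℝ) - 1) * (M₁.choose x : ℝ) * ((M₂ + L).choose (K - x) : ℝ)) := by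
    rw [mul_sum, mul_sum, mul_sum, ← sum_add_distrib, ← sum_sub_distrib]
    refine sum_congr rfl fun x _ => ?_
    ring
  rw [hexp]
  have hV := HypMoments.vandermonde M₁ (M₂ + L) K
  have hF1 := HypMoments.first_moment M₁ (M₂ + L) K
  have hF2 := HypMoments.second_fact_moment M₁ (M₂ + L) K
  rw [hV] at hF1 hF2 ⊢
  have eN : ((M₁ + M₂ + L : ℕ) : ℝ) = (M₁ : ℝ) + ((M₂ + L : ℕ) : ℝ) := by push_cast; ring
  have eNL : ((M₁ + (M₂ + L)).choose K : ℝ) = ((M₁ + M₂ + L).choose K : ℝ) := by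
    rw [show M₁ + (M₂ + L) = M₁ + M₂ + L by ring]
  rw [eNL] at hV hF1 hF2 ⊢
  rw [eN]
  push_cast at hF1 hF2 ⊢
  -- N (N-1) times the first/second moment sums are known; combine
  set S1 := ∑ x ∈ range (K + 1), (x : ℝ) * (M₁.choose x : ℝ) * ((M₂ + L).choose (K - x) : ℝ) with hS1
  set S2 := ∑ x ∈ range (K + 1), (x : ℝ) * ((x : ℝ) - 1) * (M₁.choose x : ℝ) *
    ((M₂ + L).choose (K - x) : ℝ) with hS2
  set CN := ((M₁ + M₂ + L).choose K : ℝ) with hCN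
  -- hF1 : (M₁ + (M₂+L)) * S1 = M₁ * K * CN ; hF2 : (..)(..-1) S2 = M₁(M₁-1)K(K-1) CN
  linear_combination ((M₂ : ℝ) * (4 * (K : ℝ) - 2 * M₂ - 2 * L + 2 * M₁ - 4) *
      (((M₁ : ℝ) + ((M₂ : ℝ) + L)) - 1)) * hF1 - (4 * (M₂ : ℝ)) * hF2

/-- **THEOREM U-LC with the explicit constant (note §3).**  Let `N = M₁+M₂+L`, `2K + j = N`, `κ ≥ 0` with
`κ N(N-1) ≥ M₁M₂(N - (N-2K)²)` (i.e. `κ ≥ M₁M₂(N-j²)₊/(N(N-1))`, the constant of CONJECTURE U), `w₁, w₂ ≥ 0`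
symmetric unimodal weights, and suppose `Φ_j(t) = C(L,t)+C(L,t-j)` is two-point log-concave (⟸ `j² ≤ L+3`).
Then `∑ C(M₁,x₁)w₁(x₁)C(M₂,x₂)w₂(x₂)C(L,K-x₁-x₂)(κ + (2x₁-M₁)(2x₂-M₂)) ≥ 0`, i.e.
`E_w[d₁d₂] ≥ -κ` — CONJECTURE U in the log-concave regime; hence TEST(j) there (room `κ ≤ M₁M₂/(N-1+j)`). -/
theorem u_lc_kappa (M₁ M₂ L K j : ℕ) (hN : 2 * K + j = M₁ + M₂ + L) (κ : ℝ) (hκ : 0 ≤ κ)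
    (hκ₀ : (M₁ : ℝ) * M₂ * (((M₁ + M₂ + L : ℕ) : ℝ) - (((M₁ + M₂ + L : ℕ) : ℝ) - 2 * K) ^ 2) ≤
      κ * (((M₁ + M₂ + L : ℕ) : ℝ) * (((M₁ + M₂ + L : ℕ) : ℝ) - 1)))
    (w₁ w₂ : ℕ → ℝ) (hw₁nn : ∀ x, 0 ≤ w₁ x)
    (hw₁sym : ∀ x, x ≤ M₁ → w₁ x = w₁ (M₁ - x)) (hw₁uni : ∀ x, 2 * x + 2 ≤ M₁ → w₁ x ≤ w₁ (x + 1))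
    (hw₂nn : ∀ x, 0 ≤ w₂ x)
    (hw₂sym : ∀ x, x ≤ M₂ → w₂ x = w₂ (M₂ - x)) (hw₂uni : ∀ x, 2 * x + 2 ≤ M₂ → w₂ x ≤ w₂ (x + 1))
    (hlc : ∀ m m', m ≤ m' →
      ((L.choose m : ℝ) + (if j ≤ m then (L.choose (m - j) : ℝ) else 0)) *
        ((L.choose (m' + 1) : ℝ) + (if j ≤ m' + 1 then (L.choose (m' + 1 - j) : ℝ) else 0)) ≤
      ((L.choose (m + 1) : ℝ) + (if j ≤ m + 1 then (L.choose (m + 1 - j) : ℝ) else 0)) *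
        ((L.choose m' : ℝ) + (if j ≤ m' then (L.choose (m' - j) : ℝ) else 0))) :
    0 ≤ ∑ x₁ ∈ range (M₁ + 1), ∑ x₂ ∈ range (M₂ + 1),
        (M₁.choose x₁ : ℝ) * w₁ x₁ * ((M₂.choose x₂ : ℝ) * w₂ x₂) *
          (if x₁ + x₂ ≤ K then (L.choose (K - (x₁ + x₂)) : ℝ) else 0) *
          (κ + (2 * (x₁ : ℝ) - M₁) * (2 * (x₂ : ℝ) - M₂)) := by
  refine ULC.u_lc M₁ M₂ L K j hN κ hκ w₁ w₂ hw₁nn hw₁sym hw₁uni hw₂nn hw₂sym hw₂uni hlc ?_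
  -- the untilted sum is nonnegative
  rcases Nat.eq_zero_or_pos M₁ with hM₁ | hM₁
  · -- M₁ = 0: d₁ = 0 termwise
    subst hM₁
    refine sum_nonneg fun x₁ hx₁ => sum_nonneg fun x₂ _ => ?_
    have hx : x₁ = 0 := by
      have := mem_range.mp hx₁
      omega
    subst hx
    have hg : 0 ≤ (if 0 + x₂ ≤ K then (L.choose (K - (0 + x₂)) : ℝ) else 0) := by
      split_ifs <;> positivity
    have : (κ + (2 * ((0 : ℕ) : ℝ) - ((0 : ℕ) : ℝ)) * (2 * (x₂ : ℝ) - M₂)) = κ := by push_cast; ring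
    rw [this]
    exact mul_nonneg (mul_nonneg (by positivity) hg) hκ
  rcases Nat.eq_zero_or_pos M₂ with hM₂ | hM₂
  · subst hM₂
    refine sum_nonneg fun x₁ _ => sum_nonneg fun x₂ hx₂ => ?_
    have hx : x₂ = 0 := by
      have := mem_range.mp hx₂
      omega
    subst hx
    have hg : 0 ≤ (if x₁ + 0 ≤ K then (L.choose (K - (x₁ + 0)) : ℝ) else 0) := by
      split_ifs <;> positivity
    have : (κ + (2 * (x₁ : ℝ) - M₁) * (2 * ((0 : ℕ) : ℝ) - ((0 : ℕ) : ℝ))) = κ := by push_cast; ring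
    rw [this]
    exact mul_nonneg (mul_nonneg (by positivity) hg) hκ
  -- M₁, M₂ ≥ 1: divide the identity `untilted_total` by N(N-1)(M₂+L) > 0
  have hid := untilted_total M₁ M₂ L K κ
  have hN2 : (2 : ℝ) ≤ ((M₁ + M₂ + L : ℕ) : ℝ) := by
    have : 2 ≤ M₁ + M₂ + L := by omega
    exact_mod_cast this
  have hn₂ : (1 : ℝ) ≤ (M₂ : ℝ) + L := by
    have : 1 ≤ M₂ + L := by omega
    exact_mod_cast this
  have hc : 0 < ((M₁ + M₂ + L : ℕ) : ℝ) * (((M₁ + M₂ + L : ℕ) : ℝ) - 1) * ((M₂ : ℝ) + L) := by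
    have h1 : 0 < ((M₁ + M₂ + L : ℕ) : ℝ) := by linarith
    have h2 : 0 < ((M₁ + M₂ + L : ℕ) : ℝ) - 1 := by linarith
    have h3 : 0 < (M₂ : ℝ) + L := by linarith
    positivity
  have hrhs : 0 ≤ ((M₂ : ℝ) + L) * ((M₁ + M₂ + L).choose K : ℝ) *
      (κ * (((M₁ + M₂ + L : ℕ) : ℝ) * (((M₁ + M₂ + L : ℕ) : ℝ) - 1)) +
        (M₁ : ℝ) * M₂ * ((((M₁ + M₂ + L : ℕ) : ℝ) - 2 * K) ^ 2 - ((M₁ + M₂ + L : ℕ) : ℝ))) := by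
    refine mul_nonneg (mul_nonneg (by linarith) (by positivity)) ?_
    linarith
  rw [← hid] at hrhs
  exact nonneg_of_mul_nonneg_right hrhs hc

/-- **U-LC with the explicit constant at the centre (`j = 0`, `2K = N`)**: for `κ ≥ 0` with
`κ N(N-1) ≥ M₁M₂ N` (i.e. `κ ≥ M₁M₂/(N-1)`) and all symmetric unimodal tilts, the tilted two-block sum is
nonnegative.  (The tilted CORE/TEST(0) inequality for arbitrary symmetric unimodal tilts.) -/
theorem u_lc_kappa_zero (M₁ M₂ L K : ℕ) (hN : 2 * K = M₁ + M₂ + L) (κ : ℝ) (hκ : 0 ≤ κ)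
    (hκ₀ : (M₁ : ℝ) * M₂ * (((M₁ + M₂ + L : ℕ) : ℝ) - (((M₁ + M₂ + L : ℕ) : ℝ) - 2 * K) ^ 2) ≤
      κ * (((M₁ + M₂ + L : ℕ) : ℝ) * (((M₁ + M₂ + L : ℕ) : ℝ) - 1)))
    (w₁ w₂ : ℕ → ℝ) (hw₁nn : ∀ x, 0 ≤ w₁ x)
    (hw₁sym : ∀ x, x ≤ M₁ → w₁ x = w₁ (M₁ - x)) (hw₁uni : ∀ x, 2 * x + 2 ≤ M₁ → w₁ x ≤ w₁ (x + 1))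
    (hw₂nn : ∀ x, 0 ≤ w₂ x)
    (hw₂sym : ∀ x, x ≤ M₂ → w₂ x = w₂ (M₂ - x)) (hw₂uni : ∀ x, 2 * x + 2 ≤ M₂ → w₂ x ≤ w₂ (x + 1)) :
    0 ≤ ∑ x₁ ∈ range (M₁ + 1), ∑ x₂ ∈ range (M₂ + 1),
        (M₁.choose x₁ : ℝ) * w₁ x₁ * ((M₂.choose x₂ : ℝ) * w₂ x₂) *
          (if x₁ + x₂ ≤ K then (L.choose (K - (x₁ + x₂)) : ℝ) else 0) *
          (κ + (2 * (x₁ : ℝ) - M₁) * (2 * (x₂ : ℝ) - M₂)) :=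
  u_lc_kappa M₁ M₂ L K 0 (by omega) κ hκ hκ₀ w₁ w₂ hw₁nn hw₁sym hw₁uni hw₂nn hw₂sym hw₂uni
    (fun m m' h => TwoLevel.phi_lc2_zero L m m' h)

/-- **U-LC with the explicit constant one step off the centre (`j = 1`, `2K+1 = N`)**: for `κ ≥ 0` with
`κ N(N-1) ≥ M₁M₂(N-1)` and all symmetric unimodal tilts, the tilted two-block sum is nonnegative (the tilted
TEST(1) inequality for arbitrary symmetric unimodal tilts). -/
theorem u_lc_kappa_one (M₁ M₂ L K : ℕ) (hN : 2 * K + 1 = M₁ + M₂ + L) (κ : ℝ) (hκ : 0 ≤ κ)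
    (hκ₀ : (M₁ : ℝ) * M₂ * (((M₁ + M₂ + L : ℕ) : ℝ) - (((M₁ + M₂ + L : ℕ) : ℝ) - 2 * K) ^ 2) ≤
      κ * (((M₁ + M₂ + L : ℕ) : ℝ) * (((M₁ + M₂ + L : ℕ) : ℝ) - 1)))
    (w₁ w₂ : ℕ → ℝ) (hw₁nn : ∀ x, 0 ≤ w₁ x)
    (hw₁sym : ∀ x, x ≤ M₁ → w₁ x = w₁ (M₁ - x)) (hw₁uni : ∀ x, 2 * x + 2 ≤ M₁ → w₁ x ≤ w₁ (x + 1))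
    (hw₂nn : ∀ x, 0 ≤ w₂ x)
    (hw₂sym : ∀ x, x ≤ M₂ → w₂ x = w₂ (M₂ - x)) (hw₂uni : ∀ x, 2 * x + 2 ≤ M₂ → w₂ x ≤ w₂ (x + 1)) :
    0 ≤ ∑ x₁ ∈ range (M₁ + 1), ∑ x₂ ∈ range (M₂ + 1),
        (M₁.choose x₁ : ℝ) * w₁ x₁ * ((M₂.choose x₂ : ℝ) * w₂ x₂) *
          (if x₁ + x₂ ≤ K then (L.choose (K - (x₁ + x₂)) : ℝ) else 0) *
          (κ + (2 * (x₁ : ℝ) - M₁) * (2 * (x₂ : ℝ) - M₂)) :=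
  u_lc_kappa M₁ M₂ L K 1 hN κ hκ hκ₀ w₁ w₂ hw₁nn hw₁sym hw₁uni hw₂nn hw₂sym hw₂uni
    (fun m m' h => TwoLevel.phi_lc2_one L m m' h)

end ULCKappa

end Summit.CriticalPhenomena.PercolationContinuityZ3.Theorems
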